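import Summits.QuantumFields.YangMills.Theorems.TunedSequenceExists.Negative.Glue

/-!
# Crux `OSLegsFromFemtoAndGap` (stmt-QuantumFields-9367), line `dlr-collar-transfer`: interval pinning (aux for `stub_pin`)

Support file for the repaired form of the registered stub `stub_pin` of the skeleton
`Cruxes/OSLegsFromFemtoAndGap/Lines/dlr_collar_transfer.lean` (route `LangevinControlUV` of `YangMills`).
As typed, `stub_pin : TwoPoint → GapInUnits → TwoPointPinned` for an ARBITRARY unit map `a` is the crux's own
typing residue (Disproof §6/§8).  Under the tenure repair R1′ (`Continuous a`) the extra clause of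
`TwoPointPinned` — the shape function `Γ` of the femto two-point package is bounded below by a positive
constant on every compact interval `[s₁, s₂]` with `0 < s₁`, `8 s₂ ≤ ℓ₀` — follows from the package H1 alone.
This file proves that, free of the line's vocabulary (so that it lands independently of the route Defs file):

* `exists_forall_le_of_tendsto_zero` — a continuous positive `a` with `a → 0` attains its supremum on `[β₀, ∞)`;
* `intervalPinning` — the abstract pinning argument: if for every separation `N ≥ 1` some CONTINUOUS function
  `Φ_N` of the coupling is sandwiched `c Γ(N a β) ≤ Φ_N β ≤ C Γ(N a β)` on the femto couplings
  (`β ≥ β₀`, `8 N a β ≤ ℓ₀`), and `Γ > 0` on `(0, ℓ₀]`, then `Γ` is bounded below on `[s₁, s₂]`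
  (maximum of `a`, `N = ⌈s₂ / max a⌉`, intermediate value theorem, minimum of `Φ_N` on the compact set of
  couplings `β` with `N a β ∈ [s₁, s₂]`);
* `continuous_wilsonExpectation_beta`, `continuous_axisCov` — the sandwiched function of H1's axis clause,
  `N⁸ · Cov_{β, L}(P_{0,01}, P_{N e₂,01})` on a fixed torus, is continuous in `β` (tree: Wilson expectations of
  continuous observables are continuous in the coupling, `TunedSequenceExists.Negative.Glue`);
* `pinning_of_femtoBox` — the pinning clause from the verbatim `let`-body of H1 (`TwoPoint`) for continuous `a`.

The stub file `LangevinControlUVOSLegsFromFemtoAndGapStubPinOfContinuous.lean` assembles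
`TwoPoint G r a → TwoPointPinned G r a` for continuous `a` from `pinning_of_femtoBox` in three lines.
-/

set_option autoImplicit false

noncomputable section

open Filter Topology MeasureTheory
open Literature.MathematicalPhysics.QuantumFieldTheory Literature.MathematicalPhysics.QuantumLattice
open Summit.QuantumFields.YangMills.Theorems.TunedSequenceExists.Negative.Freezing
  (secondCountable_of_latticeRep continuous_plaquetteHolonomy)
open Summit.QuantumFields.YangMills.Theorems.TunedSequenceExists.Negative.Glue
  (continuous_integral_wilsonMeasure)

namespace Summit.QuantumFields.YangMills.Theorems.OSLegsFromFemtoAndGap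

/-! ## §1 Real analysis: the abstract interval-pinning argument -/

section Real

/-- A continuous, positive function tending to `0` at `+∞` attains its supremum over `[β₀, ∞)`:
there is `β_M ≥ β₀` with `a β ≤ a β_M` for all `β ≥ β₀`. -/
theorem exists_forall_le_of_tendsto_zero {a : ℝ → ℝ} (ha : Continuous a) (hpos : ∀ β, 0 < a β)
    (hlim : Tendsto a atTop (𝓝 0)) (β₀ : ℝ) :
    ∃ βM : ℝ, β₀ ≤ βM ∧ ∀ β, β₀ ≤ β → a β ≤ a βM := by
  obtain ⟨B, hB⟩ := Filter.eventually_atTop.1 (hlim (Iio_mem_nhds (hpos β₀)))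
  obtain ⟨βM, hβM, hmax⟩ := (isCompact_Icc (a := β₀) (b := max β₀ B)).exists_isMaxOn
    (Set.nonempty_Icc.2 (le_max_left β₀ B)) ha.continuousOn
  refine ⟨βM, hβM.1, fun β hβ => ?_⟩
  by_cases hle : β ≤ max β₀ B
  · exact (isMaxOn_iff.1 hmax) β ⟨hβ, hle⟩
  · have h1 : a β < a β₀ := hB β ((le_max_right β₀ B).trans (not_le.1 hle).le)
    exact h1.le.trans ((isMaxOn_iff.1 hmax) β₀ ⟨le_rfl, le_max_left _ _⟩)

/-- **Interval pinning (abstract).**  Let `a` be continuous, positive, `a → 0` at `+∞`; `0 < c`;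
`Γ > 0` on `(0, ℓ₀]`; and suppose that for every separation `N ≥ 1` there is a continuous function `Φ`
of the coupling with `c Γ(N a β) ≤ Φ β ≤ C Γ(N a β)` whenever `β ≥ β₀` and `8 N a β ≤ ℓ₀`.  Then for
`0 < s₁ ≤ s₂`, `8 s₂ ≤ ℓ₀`, the shape `Γ` is bounded below by a positive constant on `[s₁, s₂]`.
Proof: `M = max_{β ≥ β₀} a` (attained at `β_M`), `N = ⌈s₂/M⌉ ≥ 1`; every `s ∈ [s₁, s₂]` is `N a(β)` for
some `β` in the compact set `K = [β_M, β'] ∩ {N a ∈ [s₁, s₂]}` (intermediate value theorem, `β'` with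
`N a < s₁` beyond it), on which `Φ ≥ c Γ(N a) > 0` has a positive minimum `m'`; then `C Γ(s) ≥ Φ ≥ m'`. -/
theorem intervalPinning {a Γ : ℝ → ℝ} {β₀ ℓ₀ c C : ℝ} (ha : Continuous a) (hpos : ∀ β, 0 < a β)
    (hlim : Tendsto a atTop (𝓝 0)) (hc : 0 < c) (hΓ : ∀ s : ℝ, 0 < s → s ≤ ℓ₀ → 0 < Γ s)
    (hΦ : ∀ N : ℕ, 1 ≤ N → ∃ Φ : ℝ → ℝ, Continuous Φ ∧ ∀ β : ℝ, β₀ ≤ β →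
      8 * ((N : ℝ) * a β) ≤ ℓ₀ → c * Γ ((N : ℝ) * a β) ≤ Φ β ∧ Φ β ≤ C * Γ ((N : ℝ) * a β))
    {s₁ s₂ : ℝ} (hs₁ : 0 < s₁) (hs₁₂ : s₁ ≤ s₂) (hs₂ : 8 * s₂ ≤ ℓ₀) :
    ∃ m : ℝ, 0 < m ∧ ∀ s : ℝ, s₁ ≤ s → s ≤ s₂ → m ≤ Γ s := by
  have hs₂pos : 0 < s₂ := hs₁.trans_le hs₁₂
  -- (i) the maximum `M = a β_M` of `a` on `[β₀, ∞)`
  obtain ⟨βM, hβM, hM⟩ := exists_forall_le_of_tendsto_zero ha hpos hlim β₀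
  have hMpos : 0 < a βM := hpos βM
  -- (ii) the separation `N = ⌈s₂ / M⌉`
  obtain ⟨N, hN1, hs₂N⟩ : ∃ N : ℕ, 1 ≤ N ∧ s₂ ≤ (N : ℝ) * a βM := by
    refine ⟨⌈s₂ / a βM⌉₊, Nat.one_le_iff_ne_zero.2 (Nat.ceil_pos.2 (div_pos hs₂pos hMpos)).ne', ?_⟩
    have h := Nat.le_ceil (s₂ / a βM)
    rw [div_le_iff₀ hMpos] at h
    exact h
  have hNpos : (0 : ℝ) < N := by exact_mod_cast hN1
  obtain ⟨Φ, hΦc, hΦb⟩ := hΦ N hN1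
  -- couplings beyond which `N · a < s₁`
  obtain ⟨B', hB'⟩ := Filter.eventually_atTop.1 (hlim (Iio_mem_nhds (div_pos hs₁ hNpos)))
  -- (iii) the compact set of couplings at which `N · a` lies in `[s₁, s₂]`
  set K : Set ℝ := Set.Icc βM (max βM B') ∩ (fun β => (N : ℝ) * a β) ⁻¹' Set.Icc s₁ s₂ with hKdef
  have hg : Continuous fun β => (N : ℝ) * a β := continuous_const.mul ha
  have hKc : IsCompact K := isCompact_Icc.inter_right (isClosed_Icc.preimage hg)
  have hIVT : ∀ s : ℝ, s₁ ≤ s → s ≤ s₂ → ∃ β ∈ K, (N : ℝ) * a β = s := by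
    intro s h1 h2
    have htop : s ≤ (N : ℝ) * a βM := h2.trans hs₂N
    have hbot : (N : ℝ) * a (max βM B') < s := by
      have h3 : a (max βM B') < s₁ / N := hB' _ (le_max_right _ _)
      rw [lt_div_iff₀ hNpos] at h3
      linarith [mul_comm (N : ℝ) (a (max βM B'))]
    obtain ⟨β, hβI, hβs⟩ :=
      intermediate_value_Icc' (le_max_left βM B') hg.continuousOn ⟨hbot.le, htop⟩
    have hβs' : (N : ℝ) * a β = s := hβs
    refine ⟨β, ⟨hβI, ?_⟩, hβs'⟩
    show (N : ℝ) * a β ∈ Set.Icc s₁ s₂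
    rw [hβs']
    exact ⟨h1, h2⟩
  have hKne : K.Nonempty := by
    obtain ⟨β, hβ, -⟩ := hIVT s₁ le_rfl hs₁₂
    exact ⟨β, hβ⟩
  -- the sandwich and positivity on `K`
  have hKΓ : ∀ β ∈ K, 0 < Γ ((N : ℝ) * a β) := fun β hβ => by
    have h1 : s₁ ≤ (N : ℝ) * a β := hβ.2.1
    have h2 : (N : ℝ) * a β ≤ s₂ := hβ.2.2
    exact hΓ _ (hs₁.trans_le h1) (by linarith)
  have hKb : ∀ β ∈ K, c * Γ ((N : ℝ) * a β) ≤ Φ β ∧ Φ β ≤ C * Γ ((N : ℝ) * a β) := fun β hβ => by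
    have h2 : (N : ℝ) * a β ≤ s₂ := hβ.2.2
    exact hΦb β (hβM.trans hβ.1.1) (by linarith)
  -- (iv) the minimum of `Φ` on `K` is positive, and `C > 0`
  obtain ⟨βm, hβmK, hmin⟩ := hKc.exists_isMinOn hKne hΦc.continuousOn
  have hm'pos : 0 < Φ βm := (mul_pos hc (hKΓ βm hβmK)).trans_le (hKb βm hβmK).1
  have hCpos : 0 < C := by
    by_contra hle
    have h1 : C * Γ ((N : ℝ) * a βm) ≤ 0 :=
      mul_nonpos_of_nonpos_of_nonneg (not_lt.1 hle) (hKΓ βm hβmK).le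
    linarith [(hKb βm hβmK).2]
  -- (v) the lower bound `m = min_K Φ / C`
  refine ⟨Φ βm / C, div_pos hm'pos hCpos, fun s h1 h2 => ?_⟩
  obtain ⟨β, hβK, hβs⟩ := hIVT s h1 h2
  have hup : Φ β ≤ C * Γ s := by rw [← hβs]; exact (hKb β hβK).2
  have hlo : Φ βm ≤ Φ β := (isMinOn_iff.1 hmin) β hβK
  rw [div_le_iff₀ hCpos, mul_comm]
  exact hlo.trans hup

end Real

/-! ## §2 The sandwiched function of H1's axis clause is continuous in the coupling -/

section Gauge

variable {G : Type} [Group G] [TopologicalSpace G] [IsTopologicalGroup G] [CompactSpace G]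
  [MeasurableSpace G] [BorelSpace G]

omit [CompactSpace G] [MeasurableSpace G] [BorelSpace G] in
/-- The plaquette cost `U ↦ N - Re tr ρ(U_p)` of a faithful lattice representation is a continuous observable
of the torus configuration. -/
theorem continuous_plaquetteCost (r : LatticeRep G) {L : ℕ} (x : Site 4 L) (i j : Fin 4) :
    Continuous fun U : GaugeConfig 4 L G => (r.N : ℝ) - (r.ρ (plaquetteHolonomy U x i j)).trace.re :=
  continuous_const.sub ((continuous_trace_re r.ρ r.continuous).comp (continuous_plaquetteHolonomy x i j))

/-- **Continuity in the coupling** of the Wilson expectation of a continuous observable on a fixed torus, for a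
faithful lattice representation `r` (second countability of `G` comes from the closed embedding `r.ρ`; the tree's
`TunedSequenceExists.Negative.Glue.continuous_integral_wilsonMeasure`, dominated convergence). -/
theorem continuous_wilsonExpectation_beta (r : LatticeRep G) {L : ℕ} [NeZero L]
    {F : GaugeConfig 4 L G → ℝ} (hF : Continuous F) :
    Continuous fun β : ℝ => wilsonExpectation (d := 4) (L := L) r.ρ β F := by
  haveI : SecondCountableTopology G := secondCountable_of_latticeRep r
  exact continuous_integral_wilsonMeasure r.ρ r.continuous hF

/-- **The axis covariance functional is continuous in `β`.**  For a fixed torus `(ℤ/L)⁴`, two plaquettes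
`(x, i, j)`, `(y, i', j')` and a weight `w`, the function
`β ↦ w · (⟨P_x P_y⟩_β - ⟨P_x⟩_β ⟨P_y⟩_β)` of plaquette costs is continuous on `ℝ`. -/
theorem continuous_axisCov (r : LatticeRep G) {L : ℕ} [NeZero L] (x y : Site 4 L) (i j i' j' : Fin 4)
    (w : ℝ) :
    Continuous fun β : ℝ => w *
      (wilsonExpectation (d := 4) (L := L) r.ρ β (fun U : GaugeConfig 4 L G =>
          ((r.N : ℝ) - (r.ρ (plaquetteHolonomy U x i j)).trace.re) *
            ((r.N : ℝ) - (r.ρ (plaquetteHolonomy U y i' j')).trace.re)) -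
        wilsonExpectation (d := 4) (L := L) r.ρ β (fun U : GaugeConfig 4 L G =>
            (r.N : ℝ) - (r.ρ (plaquetteHolonomy U x i j)).trace.re) *
          wilsonExpectation (d := 4) (L := L) r.ρ β (fun U : GaugeConfig 4 L G =>
            (r.N : ℝ) - (r.ρ (plaquetteHolonomy U y i' j')).trace.re)) :=
  continuous_const.mul
    ((continuous_wilsonExpectation_beta r ((continuous_plaquetteCost r x i j).mul
        (continuous_plaquetteCost r y i' j'))).sub
      ((continuous_wilsonExpectation_beta r (continuous_plaquetteCost r x i j)).mul
        (continuous_wilsonExpectation_beta r (continuous_plaquetteCost r y i' j'))))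

/-! ## §3 Pinning from the verbatim box clause of H1 -/

/-- **Interval pinning for the femto two-point package (continuous unit map).**  From the data of H1
(`TwoPoint`: positivity and vanishing of the unit map `a`, positivity of the shape `Γ` on `(0, ℓ₀]`, and the
verbatim femto-box clause on all tori `L a(β) ≤ ℓ₀`, `β ≥ β₀`) and continuity of `a`, the shape function is
bounded below by a positive constant on every `[s₁, s₂]` with `0 < s₁ ≤ s₂`, `8 s₂ ≤ ℓ₀`: the axis clause at
separation `N` on the torus `L = 8N` sandwiches the continuous `β ↦ N⁸ Cov_{β,8N}(P_0, P_{N e₂})`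
(`continuous_axisCov`) between `c Γ(N a β)` and `C Γ(N a β)`, and `intervalPinning` applies. -/
theorem pinning_of_femtoBox (r : LatticeRep G) {a : ℝ → ℝ} (ha : Continuous a) {Γ : ℝ → ℝ}
    {β₀ ℓ₀ c C : ℝ} (hc : 0 < c) (hpos : ∀ β, 0 < a β) (hlim : Filter.Tendsto a Filter.atTop (nhds 0))
    (hΓ : ∀ s : ℝ, 0 < s → s ≤ ℓ₀ → 0 < Γ s ∧ Γ s ≤ 1)
    (hbox : ∀ (L : ℕ) [NeZero L] (β : ℝ), β₀ ≤ β → (L : ℝ) * a β ≤ ℓ₀ → let P : (Fin 4 → ZMod L) → Fin 4 → Fin 4 → GaugeConfig 4 L G → ℝ := fun x i j U => (r.N : ℝ) - (r.ρ (plaquetteHolonomy U x i j)).trace.re; let E : (GaugeConfig 4 L G → ℝ) → ℝ := fun F => wilsonExpectation (d := 4) (L := L) r.ρ β F; let cov : (GaugeConfig 4 L G → ℝ) → (GaugeConfig 4 L G → ℝ) → ℝ := fun F F' => E (fun U => F U * F' U) - E F * E F'; let dist : (Fin 4 → ZMod L) → (Fin 4 → ZMod L) → ℝ := fun x y => Real.sqrt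 (∑ k : Fin 4, (((x k - y k).valMinAbs : ℤ) : ℝ) ^ 2); (∀ n : ℕ, 1 ≤ n → 8 * n ≤ L → c * Γ ((n : ℝ) * a β) ≤ (n : ℝ) ^ 8 * cov (P 0 0 1) (P (Pi.single (2 : Fin 4) ((n : ℕ) : ZMod L)) 0 1) ∧ (n : ℝ) ^ 8 * cov (P 0 0 1) (P (Pi.single (2 : Fin 4) ((n : ℕ) : ZMod L)) 0 1) ≤ C * Γ ((n : ℝ) * a β)) ∧ (∀ (x y : Fin 4 → ZMod L) (i j i' j' : Fin 4), x ≠ y → i ≠ j → i' ≠ j' → |cov (P x i j) (P y i' j')| * dist x y ^ 8 ≤ C * Γ (dist x y * a β)))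
    (s₁ s₂ : ℝ) (hs₁ : 0 < s₁) (hs₁₂ : s₁ ≤ s₂) (hs₂ : 8 * s₂ ≤ ℓ₀) :
    ∃ m : ℝ, 0 < m ∧ ∀ s : ℝ, s₁ ≤ s → s ≤ s₂ → m ≤ Γ s := by
  refine intervalPinning (β₀ := β₀) (C := C) ha hpos hlim hc (fun s hs hsl => (hΓ s hs hsl).1)
    (fun N hN => ?_) hs₁ hs₁₂ hs₂
  haveI : NeZero (8 * N) := ⟨by omega⟩
  refine ⟨fun β : ℝ => (N : ℝ) ^ 8 *
      (wilsonExpectation (d := 4) (L := 8 * N) r.ρ β (fun U : GaugeConfig 4 (8 * N) G =>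
          ((r.N : ℝ) - (r.ρ (plaquetteHolonomy U 0 0 1)).trace.re) *
            ((r.N : ℝ) - (r.ρ (plaquetteHolonomy U (Pi.single (2 : Fin 4) ((N : ℕ) : ZMod (8 * N))) 0 1)).trace.re)) -
        wilsonExpectation (d := 4) (L := 8 * N) r.ρ β (fun U : GaugeConfig 4 (8 * N) G =>
            (r.N : ℝ) - (r.ρ (plaquetteHolonomy U 0 0 1)).trace.re) *
          wilsonExpectation (d := 4) (L := 8 * N) r.ρ β (fun U : GaugeConfig 4 (8 * N) G =>
            (r.N : ℝ) - (r.ρ (plaquetteHolonomy U (Pi.single (2 : Fin 4) ((N : ℕ) : ZMod (8 * N))) 0 1)).trace.re)),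
    continuous_axisCov r 0 _ 0 1 0 1 _, fun β hβ h8 => ?_⟩
  have hL : ((8 * N : ℕ) : ℝ) * a β ≤ ℓ₀ := by push_cast; linarith
  obtain ⟨hax, -⟩ := hbox (8 * N) β hβ hL
  exact hax N hN le_rfl

/-! ## §4 The registered sub-goal (closed form, axis sandwich as hypothesis) -/

/-- **Interval pinning of the femto shape function — registered sub-goal of crux stmt-QuantumFields-9367 (line
`dlr-collar-transfer`, repaired `stub_pin`), closed form.**  For every compact `G`, faithful lattice representation
`r`, CONTINUOUS positive unit map `a → 0`, shape `Γ > 0` on `(0, ℓ₀]` and constants `β₀, c > 0, C`: if on every torus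
`(ℤ/8N)⁴` at femto couplings (`β ≥ β₀`, `8 N a(β) ≤ ℓ₀`) the axis covariance `N⁸ Cov_β(P_0, P_{N e₂})` of the
plaquette costs is sandwiched between `c Γ(N a β)` and `C Γ(N a β)` (H1's axis clause at `n = N`, `L = 8N`), then
`Γ` is bounded below by a positive constant on every `[s₁, s₂]`, `0 < s₁ ≤ s₂`, `8 s₂ ≤ ℓ₀`
(`intervalPinning` + `continuous_axisCov`). -/
theorem twoPoint_intervalPinning : ∀ (G : Type) [Group G] [TopologicalSpace G] [IsTopologicalGroup G] [CompactSpace G] [MeasurableSpace G] [BorelSpace G] (r : LatticeRep G) (a Γ : ℝ → ℝ) (β₀ ℓ₀ c C : ℝ), Continuous a → 0 < c → (∀ β, 0 < a β) → Filter.Tendsto a Filter.atTop (nhds 0) → (∀ s : ℝ, 0 < s → s ≤ ℓ₀ → 0 < Γ s) → (∀ (N : ℕ) [NeZero (8 * N)] (β : ℝ), 1 ≤ N → β₀ ≤ β → 8 * ((N : ℝ) * a β) ≤ ℓ₀ → c * Γ ((N : ℝ) * a β) ≤ (N : ℝ) ^ 8 * (wilsonExpectation r.ρ β (fun U : GaugeConfig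 4 (8 * N) G => ((r.N : ℝ) - (r.ρ (plaquetteHolonomy U 0 0 1)).trace.re) * ((r.N : ℝ) - (r.ρ (plaquetteHolonomy U (Pi.single (2 : Fin 4) ((N : ℕ) : ZMod (8 * N))) 0 1)).trace.re)) - wilsonExpectation r.ρ β (fun U : GaugeConfig 4 (8 * N) G => (r.N : ℝ) - (r.ρ (plaquetteHolonomy U 0 0 1)).trace.re) * wilsonExpectation r.ρ β (fun U : GaugeConfig 4 (8 * N) G => (r.N : ℝ) - (r.ρ (plaquetteHolonomy U (Pi.single (2 : Fin 4) ((N : ℕ) : ZMod (8 * N))) 0 1)).trace.re)) ∧ (N : ℝ) ^ 8 * (wilsonExpectation r.ρ β (fun U : GaugeConfig 4 (8 * N) G => ((r.N : ℝ) - (r.ρ (plaquetteHolonomy U 0 0 1)).trace.re) * ((r.N : ℝ) - (r.ρ (plaquetteHolonomy U (Pi.single (2 : Fin 4) ((N : ℕ) : ZMod (8 * N))) 0 1)).trace.re)) - wilsonExpectation r.ρ β (fun U : GaugeConfig 4 (8 * N) G => (r.N : ℝ) - (r.ρ (plaquetteHolonomy U 0 0 1)).trace.re) * wilsonExpectation r.ρ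 β (fun U : GaugeConfig 4 (8 * N) G => (r.N : ℝ) - (r.ρ (plaquetteHolonomy U (Pi.single (2 : Fin 4) ((N : ℕ) : ZMod (8 * N))) 0 1)).trace.re)) ≤ C * Γ ((N : ℝ) * a β)) → ∀ s₁ s₂ : ℝ, 0 < s₁ → s₁ ≤ s₂ → 8 * s₂ ≤ ℓ₀ → ∃ m : ℝ, 0 < m ∧ ∀ s : ℝ, s₁ ≤ s → s ≤ s₂ → m ≤ Γ s := by
  intro G _ _ _ _ _ _ r a Γ β₀ ℓ₀ c C ha hc hpos hlim hΓ hax s₁ s₂ hs₁ hs₁₂ hs₂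
  refine intervalPinning (β₀ := β₀) (C := C) ha hpos hlim hc hΓ (fun N hN => ?_) hs₁ hs₁₂ hs₂
  haveI : NeZero (8 * N) := ⟨by omega⟩
  exact ⟨_, continuous_axisCov r (L := 8 * N) 0 (Pi.single (2 : Fin 4) ((N : ℕ) : ZMod (8 * N))) 0 1 0 1
    ((N : ℝ) ^ 8), fun β hβ h8 => hax N β hN hβ h8⟩

end Gauge

end Summit.QuantumFields.YangMills.Theorems.OSLegsFromFemtoAndGap

end
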